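import Summits.AtomisticToContinuum.Crystallization.Theorems.ChartedZeroExcessLayeredLatticeLiouvilleZZZYRA

/-!
# ChartedZeroExcess · LayeredLatticeLiouville ZZZYRD (lens-2 g98 «ElementKorn» — NODE E beneath the word-global crux (K♯)) — docket 26636

TARGET (tree ZZZYRA, (191) p858360): (K♯) `UniformContactKornP s Λ c₀ ℓ₀ r₁ cK` — the WORD-UNIFORM discrete Korn inequality of the contact truss,
`cK·N₁(φ) ≤ S₁(φ) ≤ N₁(φ)` for every admissible word at every scale and every finitely supported field.  It is the one piece of NODE D / D⁗ that is
GLOBAL IN THE WORD (g96/g97: Bloch and per-`k∥` alphabets die at long waves, slabs bend; «geometric Korn is not a usable estimate»).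

THE LENS (structural dichotomy special | generic) applied to (K♯) itself: the contact graph of every clean Barlow word is the edge set of a face-to-face
tiling of space by the slab TETRAHEDRA (4-cliques of the contact graph) and slab OCTAHEDRA (induced `K₂,₂,₂`'s), every contact pair lying in exactly
2 + 2 of them (edge figure `2·70.53° + 2·109.47° = 360°`; desk CLIQUES-98: fcc/hcp/dhcp/9R/6H, 0 exceptions, `(8, 6)` cells per atom).  Korn's
inequality WITHOUT boundary has constant exactly 2 because `|G|² = 2|sym G|² − (tr G)² + 2σ₂(G)` pointwise and `σ₂(∇u) = ½((div u)² − tr (∇u)²)` is a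
NULL LAGRANGIAN: `Σ_simplices vol·σ₂(G) = 0` for every compactly supported continuous piecewise-affine `u` (GENERIC: word-free, potential-free — the
same discrete-divergence technology as (NL♯) of D⁗).  What is left is LOCAL: one quadratic-form inequality per CELL,
  tet `t`:  `(c·S_t − N_t)/6 − μ·vol_t σ₂(G_t) ≥ 0`,   oct `o`:  `(c·S_o − N_o)/3 − μ·Σ_{4 sub-tets} vol σ₂(G) ≥ 0`
(`S`, `N` = the cell's contact stretch / displacement sums, `G` = affine gradient of the vertex interpolant, the octahedron split along a body
diagonal), with ONE multiplier `μ` per word; summing over the cells of the word (shares `2/6 + 2/3 = 1` per contact pair) gives `N₁ ≤ c·S₁`.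
SPECIAL (regular cells, every Barlow word at once): desk CELLSDP-98 finds the certificate EXACT — `c = 8`, shares `(1/6, 1/3)`, `μ = 4√2/ℓ`
(`= 4` in the integer fcc frame, all matrices rational): `cK = 1/8 = 0.125` against the Bloch infimum `0.1256–0.1286` (KORN-97) — the cell
certificate loses < 1 %.  GENERIC (strained cells of the box of record `s = 1/50`, `ρ ∈ [0.96, 1.04]`, STRAIN52 frames): `c ≤ 9.00` (`cK_cell = 0.111`,
σ₂-multiplier; `8.95` with the three diagonal minors as separate null Lagrangians), μ re-optimised per word — LOCALITY IS WHAT MAKES THE CONSTANT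
WORD-UNIFORM: no Bloch, no homogenisation, no aperiodic-word limit; each check is a 12×12 or 18×18 symmetric matrix.
PIECES (all `∀ a > 0` over `IsAdmissibleWord`, cells = `tetCells`/`octCells` of the word's own `r₁`-contact graph, labelled — 24 / 48 labellings each):
* (CS♯) `CellSumP s Λ c₀ ℓ₀ r₁` — CELL BOOKKEEPING: for finitely supported `φ` the six cell functionals have finite support on the word's cells and
  `Σ_t S_t = 24·S₁`, `Σ_t N_t = 24·N₁`, `Σ_o S_o = 48·S₁`, `Σ_o N_o = 48·N₁`.  support · SPECIAL (Barlow contact combinatorics: 4-cliques / `K₂,₂,₂`'s =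
  slab cells, edge figure 2 + 2, local finiteness from `c₀`-co-Lipschitz) · ATTACKABLE-S · why it might fail: a clean admissible word whose `r₁`-graph has
  a 4-clique or an induced `K₂,₂,₂` that is not a slab cell, or a contact pair in `≠ 2 + 2` cells — excluded on the clean window of record (CLIQUES-98).
* (NC♯) `CellNullLagrangianP s Λ c₀ ℓ₀ r₁` — THE σ₂ NULL LAGRANGIAN ON THE CELL TILING: `Σ_t NL_t/24 + Σ_o NL_o/48 = 0`.  support · GENERIC ·
  ATTACKABLE-M (per-simplex Stokes polynomial identity + internal faces cancel; oct–oct faces across h-layers are untouched by the diagonal split, so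
  every per-oct diagonal choice is a face-to-face refinement and the labelling average is harmless) · why it might fail: only through the labelling
  constants or a seam that is not face-to-face — none in a Barlow slab tiling.
* ★ (CC♯) `CellCertificateP s Λ c₀ ℓ₀ r₁ c` — THE CELL CERTIFICATE: per admissible word one `μ : ℝ` with both cell inequalities for EVERY field (no
  support hypothesis: they are cell-local).  crux (rank 2 within E) · SPECIAL∧INSTRUMENTED (regular: exact `c = 8`; box of record: `c ≤ 9.00`, desk
  CELLSDP-98 / EK-98) · ATTACKABLE-M K-class (interval LDLᵀ of two small matrices over the cell-distortion class) · why it might fail: the admissible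
  class as typed (`c₀`, `ℓ₀`, clean, Nash) may contain cells outside the desk's distortion box — then `c` is priced on the true box (census ASK
  CELLBOX-98), finite as long as cells stay non-degenerate (co-Lipschitz) · WEAKER than (K♯)/(U♯): potential-free and implies nothing about stability.
GLUE (PROVED, 0 sorry): `uniformContactKornP_of_cellCertificate : 0 ≤ cK → cK·c ≤ 1 → (CS♯) → (NC♯) → (CC♯ c) → (K♯)(cK)`; the upper half
`S₁ ≤ N₁` is termwise Cauchy–Schwarz (`pairS_le_pairN`) through (CS♯); monotonicity `uniformContactKornP_mono`; record instance `c = 9`, `cK = 1/9`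
(feeds NODE D's record `cK = 1/10`).  WHY NOVEL (vs KORN-96/97 Bloch, g96 §2c geometric Korn, UBK♯ slabs): the estimate is assembled from CELL-LOCAL
matrix inequalities plus ONE exact conservation law, so word-uniformity is by construction and the special case is an identity with closed-form
multipliers.  0 sorry · import = tree ZZZYRA · no instances/notation/options · axioms standard. [g98]
-/

noncomputable section

open scoped BigOperators InnerProductSpace RealInnerProductSpace

namespace Summit.AtomisticToContinuum.Crystallization.Theorems.ChartedZeroExcessLayeredLatticeLiouville

open Summit.AtomisticToContinuum.Crystallization.Theorems.ChartedPlanarOrderRigidityDoor (E3)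

/-! ### Labelled cells of the contact graph -/

/-- `(x, y)` is a CONTACT PAIR of the word `(a, b, w)` at cut-off `r₁`: `0 < ‖site y − site x‖ ≤ r₁` (the window of `contactForm r₁`). [g98] -/
def IsContactPair (r₁ : ℝ) (a b : E3) (w : ℤ → E3) (x y : Cell 2 × ℤ) : Prop :=
  0 < ‖lsite a b w y.1 y.2 - lsite a b w x.1 x.2‖ ∧ ‖lsite a b w y.1 y.2 - lsite a b w x.1 x.2‖ ≤ r₁

/-- the 6 vertex pairs `i < j` of a labelled tetrahedron. [g98] -/
def tetPairs : Finset (Fin 4 × Fin 4) := Finset.univ.filter fun p => p.1 < p.2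

/-- the 12 EDGE pairs `i < j` of a labelled octahedron: antipodal classes `{0,1}, {2,3}, {4,5}`, edges = non-antipodal pairs. [g98] -/
def octPairs : Finset (Fin 6 × Fin 6) := Finset.univ.filter fun p => p.1 < p.2 ∧ (p.1 : ℕ) / 2 ≠ (p.2 : ℕ) / 2

/-- the 3 ANTIPODAL pairs `(0,1), (2,3), (4,5)` of a labelled octahedron (its `√2`-diagonals; not contact pairs). [g98] -/
def octAntiPairs : Finset (Fin 6 × Fin 6) := Finset.univ.filter fun p => p.1 < p.2 ∧ (p.1 : ℕ) / 2 = (p.2 : ℕ) / 2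

/-- TETRAHEDRAL CELLS of the word: labelled 4-cliques of its `r₁`-contact graph (each geometric cell carries `4! = 24` labellings). [g98] -/
def tetCells (r₁ : ℝ) (a b : E3) (w : ℤ → E3) : Set (Fin 4 → Cell 2 × ℤ) :=
  {t | ∀ p ∈ tetPairs, IsContactPair r₁ a b w (t p.1) (t p.2)}

/-- OCTAHEDRAL CELLS of the word: labelled induced `K₂,₂,₂`'s of its `r₁`-contact graph — 12 contact pairs, the 3 antipodal pairs distinct and NOT in
contact (each geometric cell carries `3!·2³ = 48` labellings). [g98] -/
def octCells (r₁ : ℝ) (a b : E3) (w : ℤ → E3) : Set (Fin 6 → Cell 2 × ℤ) :=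
  {o | (∀ p ∈ octPairs, IsContactPair r₁ a b w (o p.1) (o p.2)) ∧
    ∀ p ∈ octAntiPairs, o p.1 ≠ o p.2 ∧ ¬ IsContactPair r₁ a b w (o p.1) (o p.2)}

/-! ### Cell functionals: contact sums, affine gradient, the σ₂ null Lagrangian -/

/-- displacement term of a vertex pair: `‖Φ j − Φ i‖²`. [g98] -/
def pairN {k : ℕ} (Φ : Fin k → E3) (p : Fin k × Fin k) : ℝ := ‖Φ p.2 - Φ p.1‖ ^ 2

/-- stretch term of a vertex pair: `⟨P j − P i, Φ j − Φ i⟩² / ‖P j − P i‖²`. [g98] -/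
def pairS {k : ℕ} (P Φ : Fin k → E3) (p : Fin k × Fin k) : ℝ := ⟪P p.2 - P p.1, Φ p.2 - Φ p.1⟫ ^ 2 / ‖P p.2 - P p.1‖ ^ 2

/-- termwise Cauchy–Schwarz: stretch ≤ displacement. [g98] -/
theorem pairS_le_pairN {k : ℕ} (P Φ : Fin k → E3) (p : Fin k × Fin k) : pairS P Φ p ≤ pairN Φ p := by
  unfold pairS pairN
  have h := abs_real_inner_le_norm (P p.2 - P p.1) (Φ p.2 - Φ p.1)
  have hM : 0 ≤ ‖P p.2 - P p.1‖ * ‖Φ p.2 - Φ p.1‖ := mul_nonneg (norm_nonneg _) (norm_nonneg _)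
  have h1 : 0 ≤ (‖P p.2 - P p.1‖ * ‖Φ p.2 - Φ p.1‖ - |⟪P p.2 - P p.1, Φ p.2 - Φ p.1⟫|) *
      (‖P p.2 - P p.1‖ * ‖Φ p.2 - Φ p.1‖ + |⟪P p.2 - P p.1, Φ p.2 - Φ p.1⟫|) :=
    mul_nonneg (sub_nonneg.2 h) (add_nonneg hM (abs_nonneg _))
  have h2 : |⟪P p.2 - P p.1, Φ p.2 - Φ p.1⟫| ^ 2 = ⟪P p.2 - P p.1, Φ p.2 - Φ p.1⟫ ^ 2 := sq_abs _
  have hcs : ⟪P p.2 - P p.1, Φ p.2 - Φ p.1⟫ ^ 2 ≤ ‖P p.2 - P p.1‖ ^ 2 * ‖Φ p.2 - Φ p.1‖ ^ 2 := by nlinarith [h1, h2]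
  by_cases he : ‖P p.2 - P p.1‖ = 0
  · have h0 : ⟪P p.2 - P p.1, Φ p.2 - Φ p.1⟫ ^ 2 / ‖P p.2 - P p.1‖ ^ 2 = 0 := by simp [he]
    rw [h0]; positivity
  · rw [div_le_iff₀ (by positivity)]
    nlinarith [hcs]

/-- edge matrix of a labelled simplex: columns `P (j+1) − P 0` (coordinates in rows). [g98] -/
def edgeMat (P : Fin 4 → E3) : Matrix (Fin 3) (Fin 3) ℝ := Matrix.of fun i j => (P j.succ - P 0) i

/-- volume of a labelled simplex: `|det (edge matrix)| / 6`. [g98] -/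
def simplexVol (P : Fin 4 → E3) : ℝ := |(edgeMat P).det| / 6

/-- AFFINE GRADIENT of the vertex interpolant of `Φ` on the simplex `P`: `G = [Φ (j+1) − Φ 0] · [P (j+1) − P 0]⁻¹` (junk on degenerate simplices,
which no cell of a co-Lipschitz word is). [g98] -/
def affGrad (P Φ : Fin 4 → E3) : Matrix (Fin 3) (Fin 3) ℝ := edgeMat Φ * (edgeMat P)⁻¹

/-- second invariant `σ₂(G) = ((tr G)² − tr (G²)) / 2` = the sum of the three principal 2×2 minors — the quadratic null Lagrangian. [g98] -/
def sigmaTwo (G : Matrix (Fin 3) (Fin 3) ℝ) : ℝ := ((Matrix.trace G) ^ 2 - Matrix.trace (G * G)) / 2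

/-- `vol · σ₂(G)` of one labelled simplex. [g98] -/
def simplexNL (P Φ : Fin 4 → E3) : ℝ := simplexVol P * sigmaTwo (affGrad P Φ)

/-- the four sub-tetrahedra of a labelled octahedron split along the body diagonal `(0, 1)` (equator cycle `2, 4, 3, 5`). [g98] -/
def octSub (k : Fin 4) : Fin 4 → Fin 6 := (![![0, 1, 2, 4], ![0, 1, 4, 3], ![0, 1, 3, 5], ![0, 1, 5, 2]] : Fin 4 → Fin 4 → Fin 6) k

/-- `Σ_{sub-tets} vol · σ₂(G)` of one labelled octahedron (diagonal split). [g98] -/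
def octNL (P Φ : Fin 6 → E3) : ℝ := ∑ k : Fin 4, simplexNL (P ∘ octSub k) (Φ ∘ octSub k)

/-- positions of a labelled cell of the word `(a, b, w)`. [g98] -/
def cellPos (a b : E3) (w : ℤ → E3) {k : ℕ} (t : Fin k → Cell 2 × ℤ) : Fin k → E3 := fun i => lsite a b w (t i).1 (t i).2

/-- values of the field `φ` at the vertices of a labelled cell. [g98] -/
def cellVal {k : ℕ} (φ : Cell 2 → ℤ → E3) (t : Fin k → Cell 2 × ℤ) : Fin k → E3 := fun i => φ (t i).1 (t i).2

/-- tet displacement sum `N_t = Σ_{6 pairs} ‖Δφ‖²`. [g98] -/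
def tetN (φ : Cell 2 → ℤ → E3) (t : Fin 4 → Cell 2 × ℤ) : ℝ := ∑ p ∈ tetPairs, pairN (cellVal φ t) p

/-- tet stretch sum `S_t = Σ_{6 pairs} ⟨e, Δφ⟩²/‖e‖²`. [g98] -/
def tetS (a b : E3) (w : ℤ → E3) (φ : Cell 2 → ℤ → E3) (t : Fin 4 → Cell 2 × ℤ) : ℝ :=
  ∑ p ∈ tetPairs, pairS (cellPos a b w t) (cellVal φ t) p

/-- tet null-Lagrangian term `vol_t · σ₂(G_t)`. [g98] -/
def tetNL (a b : E3) (w : ℤ → E3) (φ : Cell 2 → ℤ → E3) (t : Fin 4 → Cell 2 × ℤ) : ℝ := simplexNL (cellPos a b w t) (cellVal φ t)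

/-- oct displacement sum `N_o = Σ_{12 edges} ‖Δφ‖²`. [g98] -/
def octN (φ : Cell 2 → ℤ → E3) (o : Fin 6 → Cell 2 × ℤ) : ℝ := ∑ p ∈ octPairs, pairN (cellVal φ o) p

/-- oct stretch sum `S_o = Σ_{12 edges} ⟨e, Δφ⟩²/‖e‖²`. [g98] -/
def octS (a b : E3) (w : ℤ → E3) (φ : Cell 2 → ℤ → E3) (o : Fin 6 → Cell 2 × ℤ) : ℝ :=
  ∑ p ∈ octPairs, pairS (cellPos a b w o) (cellVal φ o) p

/-- oct null-Lagrangian term `Σ_{4 sub-tets} vol · σ₂(G)`. [g98] -/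
def octNLw (a b : E3) (w : ℤ → E3) (φ : Cell 2 → ℤ → E3) (o : Fin 6 → Cell 2 × ℤ) : ℝ := octNL (cellPos a b w o) (cellVal φ o)

/-- share-weighted TET CERTIFICATE functional `(c·S_t − N_t)/6 − μ·NL_t` (share `1/6`: each contact pair lies in 2 tets + 2 octs). [g98] -/
def tetCert (c μ : ℝ) (a b : E3) (w : ℤ → E3) (φ : Cell 2 → ℤ → E3) (t : Fin 4 → Cell 2 × ℤ) : ℝ :=
  (c * tetS a b w φ t - tetN φ t) / 6 - μ * tetNL a b w φ t

/-- share-weighted OCT CERTIFICATE functional `(c·S_o − N_o)/3 − μ·NL_o` (share `1/3`). [g98] -/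
def octCert (c μ : ℝ) (a b : E3) (w : ℤ → E3) (φ : Cell 2 → ℤ → E3) (o : Fin 6 → Cell 2 × ℤ) : ℝ :=
  (c * octS a b w φ o - octN φ o) / 3 - μ * octNLw a b w φ o

/-- the tet contact functional is dominated termwise by the tet count functional (`pairS_le_pairN` summed). [g98] -/
theorem tetS_le_tetN (a b : E3) (w : ℤ → E3) (φ : Cell 2 → ℤ → E3) (t : Fin 4 → Cell 2 × ℤ) : tetS a b w φ t ≤ tetN φ t :=
  Finset.sum_le_sum fun p _ => pairS_le_pairN _ _ p

/-- the oct contact functional is dominated termwise by the oct count functional (`pairS_le_pairN` summed). [g98] -/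
theorem octS_le_octN (a b : E3) (w : ℤ → E3) (φ : Cell 2 → ℤ → E3) (o : Fin 6 → Cell 2 × ℤ) : octS a b w φ o ≤ octN φ o :=
  Finset.sum_le_sum fun p _ => pairS_le_pairN _ _ p

/-- the windowed stretch forms are non-negative (`finsum` of squares over squares). [g98] -/
theorem stretchForm_nonneg (rlo rhi : ℝ) (a b : E3) (w : ℤ → E3) (φ : Cell 2 → ℤ → E3) : 0 ≤ stretchForm rlo rhi a b w φ :=
  finsum_nonneg fun x => by
    split_ifs <;> positivity

/-! ### The pieces -/

/-- **(CS♯) «CellSumP s Λ c₀ ℓ₀ r₁»** — CELL BOOKKEEPING of the contact currencies: on an admissible word, for a finitely supported field, the six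
cell functionals are finitely supported on the word's labelled cells and the contact STRETCH / DISPLACEMENT forms are cell sums:
`Σ_t S_t = 24·S₁`, `Σ_t N_t = 24·N₁`, `Σ_o S_o = 48·S₁`, `Σ_o N_o = 48·N₁` (ordered-pair forms; 24 / 48 labellings; every contact pair in exactly
2 tets + 2 octs).  support · SPECIAL (Barlow contact combinatorics on the clean window: 4-cliques and induced `K₂,₂,₂`'s of the contact graph ARE the
slab cells; desk CLIQUES-98) · ATTACKABLE-S · WEAKER than (K♯): identities, no inequality.  Why it might fail: a clean admissible word with a contact
pair in `≠ 2 + 2` cells or a spurious clique (none in fcc/hcp/dhcp/9R/6H patches; the clean gap excludes `√2`-pairs from the window).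
Sources: CLIQUES-98 desk; Conway–Sloane SPLAG ch. 1 (tet/oct honeycomb of the Barlow packings); memo NODE-g98 §2. [g98] -/
def CellSumP (s Λ c₀ ℓ₀ r₁ : ℝ) : Prop :=
  ∀ a : ℝ, 0 < a → ∀ (L : E3 ≃L[ℝ] E3) (w' : ℤ → E3), IsAdmissibleWord a s Λ c₀ ℓ₀ L w' →
    ∀ φ : Cell 2 → ℤ → E3, HasFiniteSupport φ →
      (Function.HasFiniteSupport fun t : tetCells r₁ (gen₁ L) (gen₂ L) w' => tetS (gen₁ L) (gen₂ L) w' φ t) ∧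
      (Function.HasFiniteSupport fun t : tetCells r₁ (gen₁ L) (gen₂ L) w' => tetN φ t) ∧
      (Function.HasFiniteSupport fun t : tetCells r₁ (gen₁ L) (gen₂ L) w' => tetNL (gen₁ L) (gen₂ L) w' φ t) ∧
      (Function.HasFiniteSupport fun o : octCells r₁ (gen₁ L) (gen₂ L) w' => octS (gen₁ L) (gen₂ L) w' φ o) ∧
      (Function.HasFiniteSupport fun o : octCells r₁ (gen₁ L) (gen₂ L) w' => octN φ o) ∧
      (Function.HasFiniteSupport fun o : octCells r₁ (gen₁ L) (gen₂ L) w' => octNLw (gen₁ L) (gen₂ L) w' φ o) ∧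
      ∑ᶠ t : tetCells r₁ (gen₁ L) (gen₂ L) w', tetS (gen₁ L) (gen₂ L) w' φ t = 24 * stretchForm 0 r₁ (gen₁ L) (gen₂ L) w' φ ∧
      ∑ᶠ t : tetCells r₁ (gen₁ L) (gen₂ L) w', tetN φ t = 24 * contactForm r₁ (gen₁ L) (gen₂ L) w' φ ∧
      ∑ᶠ o : octCells r₁ (gen₁ L) (gen₂ L) w', octS (gen₁ L) (gen₂ L) w' φ o = 48 * stretchForm 0 r₁ (gen₁ L) (gen₂ L) w' φ ∧
      ∑ᶠ o : octCells r₁ (gen₁ L) (gen₂ L) w', octN φ o = 48 * contactForm r₁ (gen₁ L) (gen₂ L) w' φ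

/-- **(NC♯) «CellNullLagrangianP s Λ c₀ ℓ₀ r₁»** — THE σ₂ NULL LAGRANGIAN on the cell tiling of an admissible word: for a finitely supported field,
`Σ_t vol_t σ₂(G_t)/24 + Σ_o (Σ_sub vol σ₂(G))/48 = 0` — the discrete `∫ σ₂(∇u) = 0` for the continuous piecewise-affine vertex interpolant `u` of `φ`
(compactly supported) on the face-to-face simplicial refinement of the slab tiling (octahedra split along a body diagonal; the labelling sum averages
the three diagonals, each a valid refinement since oct–oct faces across h-layers are untouched).  support · GENERIC (word-free, potential-free,
scale-free) · ATTACKABLE-M (per simplex `vol·σ₂(G)` is a boundary bilinear form in vertex values and face normals; internal faces cancel pairwise —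
the (NL♯) technology of D⁗) · WEAKER than (K♯): an identity.  Why it might fail: only through the labelling constants 24/48 or a seam of the tiling that
is not face-to-face (none).  Sources: Ball, Arch. Rational Mech. Anal. 63 (1977) §3 (null Lagrangians = minors); Ciarlet, Mathematical Elasticity I
Thm 1.6-1 (Piola identity); memo NODE-g98 §2. [g98] -/
def CellNullLagrangianP (s Λ c₀ ℓ₀ r₁ : ℝ) : Prop :=
  ∀ a : ℝ, 0 < a → ∀ (L : E3 ≃L[ℝ] E3) (w' : ℤ → E3), IsAdmissibleWord a s Λ c₀ ℓ₀ L w' →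
    ∀ φ : Cell 2 → ℤ → E3, HasFiniteSupport φ →
      (∑ᶠ t : tetCells r₁ (gen₁ L) (gen₂ L) w', tetNL (gen₁ L) (gen₂ L) w' φ t) / 24 +
        (∑ᶠ o : octCells r₁ (gen₁ L) (gen₂ L) w', octNLw (gen₁ L) (gen₂ L) w' φ o) / 48 = 0

/-- ★ **(CC♯) «CellCertificateP s Λ c₀ ℓ₀ r₁ c»** — THE CELL CERTIFICATE: for every admissible word there is ONE null-Lagrangian multiplier `μ : ℝ`
such that for EVERY field (no support hypothesis — the inequalities are cell-local) every tetrahedral cell has `(c·S_t − N_t)/6 − μ·vol_t σ₂(G_t) ≥ 0`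
and every octahedral cell `(c·S_o − N_o)/3 − μ·Σ_sub vol σ₂(G) ≥ 0` (as quadratic forms on 12 / 18 vertex dofs: two small symmetric matrices per
cell geometry, PSD).  crux (rank 2 within E) · SPECIAL∧INSTRUMENTED: REGULAR cells (every Barlow word at once) — EXACT `c = 8`, `μ = 4√2/ℓ` (desk
CELLSDP-98, `8.000000`; tight at the rigid rotations and at the tetragonal shear); box of record (`s = 1/50`, `ρ ∈ [0.96, 1.04]`, STRAIN52 frames,
μ common to `ρ`-mixtures within a word) — `c ≤ 9.00`, worst frame x (desk CELLSDP-98 / EK-98) · ATTACKABLE-M K-class (interval LDLᵀ over the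
cell-distortion class; regular case rational) · WEAKER than (K♯)/(U♯): potential-free, cell-local.  Why it might fail: admissible cells outside the
desk's distortion box (the typed class bounds distortion only through `c₀`, `ℓ₀`, clean, Nash) — then `c` is re-priced on the true box (census ASK
CELLBOX-98); it stays finite while cells are non-degenerate.  Sources: CELLSDP-98 / EK-98 desk; Korn's inequality without boundary via
`‖∇u‖² = 2‖e(u)‖² − (div u)² + 2σ₂` (Ciarlet I §6.3); memo NODE-g98 §2–§3. [g98] -/
def CellCertificateP (s Λ c₀ ℓ₀ r₁ c : ℝ) : Prop :=
  ∀ a : ℝ, 0 < a → ∀ (L : E3 ≃L[ℝ] E3) (w' : ℤ → E3), IsAdmissibleWord a s Λ c₀ ℓ₀ L w' →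
    ∃ μ : ℝ, ∀ φ : Cell 2 → ℤ → E3,
      (∀ t ∈ tetCells r₁ (gen₁ L) (gen₂ L) w', 0 ≤ tetCert c μ (gen₁ L) (gen₂ L) w' φ t) ∧
        ∀ o ∈ octCells r₁ (gen₁ L) (gen₂ L) w', 0 ≤ octCert c μ (gen₁ L) (gen₂ L) w' φ o

/-! ### Glue -/

/-- finsum bookkeeping: the share-weighted certificate sum splits into its three finitely supported parts. [g98] -/
theorem finsum_cert_expand {ι : Type*} {f g h : ι → ℝ} (hf : Function.HasFiniteSupport f) (hg : Function.HasFiniteSupport g)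
    (hh : Function.HasFiniteSupport h) (c μ k : ℝ) :
    ∑ᶠ i, ((c * f i - g i) / k - μ * h i) = (c * ∑ᶠ i, f i - ∑ᶠ i, g i) / k - μ * ∑ᶠ i, h i := by
  classical
  have sf : Function.support f ⊆ ↑(hf.toFinset ∪ hg.toFinset ∪ hh.toFinset) := fun i hi => by
    simp only [Finset.coe_union, Set.Finite.coe_toFinset, Set.mem_union]; exact Or.inl (Or.inl hi)
  have sg : Function.support g ⊆ ↑(hf.toFinset ∪ hg.toFinset ∪ hh.toFinset) := fun i hi => by
    simp only [Finset.coe_union, Set.Finite.coe_toFinset, Set.mem_union]; exact Or.inl (Or.inr hi)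
  have sh : Function.support h ⊆ ↑(hf.toFinset ∪ hg.toFinset ∪ hh.toFinset) := fun i hi => by
    simp only [Finset.coe_union, Set.Finite.coe_toFinset, Set.mem_union]; exact Or.inr hi
  have sF : Function.support (fun i => (c * f i - g i) / k - μ * h i) ⊆ ↑(hf.toFinset ∪ hg.toFinset ∪ hh.toFinset) := by
    intro i hi
    by_contra hic
    have hf0 : f i = 0 := by
      by_contra h0; exact hic (sf (Function.mem_support.mpr h0))
    have hg0 : g i = 0 := by
      by_contra h0; exact hic (sg (Function.mem_support.mpr h0))
    have hh0 : h i = 0 := by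
      by_contra h0; exact hic (sh (Function.mem_support.mpr h0))
    exact hi (by simp [hf0, hg0, hh0])
  rw [finsum_eq_sum_of_support_subset _ sF, finsum_eq_sum_of_support_subset _ sf, finsum_eq_sum_of_support_subset _ sg,
    finsum_eq_sum_of_support_subset _ sh, Finset.sum_sub_distrib, ← Finset.mul_sum, ← Finset.sum_div, Finset.sum_sub_distrib, ← Finset.mul_sum]

/-- THE CELL ARITHMETIC (pure real inequalities): two non-negative share-weighted certificate sums + the null-Lagrangian identity + the bookkeeping
identities ⇒ `N₁ ≤ c·S₁`, hence `cK·N₁ ≤ S₁` for `0 ≤ cK`, `cK·c ≤ 1`. [g98] -/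
theorem cell_arith {T₁ T₂ S₁ N₁ L₁ L₂ μ c cK : ℝ} (h1 : 0 ≤ T₁) (h2 : 0 ≤ T₂) (e1 : T₁ = (c * (24 * S₁) - 24 * N₁) / 6 - μ * L₁)
    (e2 : T₂ = (c * (48 * S₁) - 48 * N₁) / 3 - μ * L₂) (e0 : L₁ / 24 + L₂ / 48 = 0) (hS : 0 ≤ S₁) (hcK : 0 ≤ cK) (hc : cK * c ≤ 1) :
    cK * N₁ ≤ S₁ := by
  have e0' : μ * L₁ / 24 + μ * L₂ / 48 = 0 := by
    have := congrArg (fun x => μ * x) e0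
    simp only [mul_add, mul_zero] at this
    linarith [this]
  have hN : N₁ ≤ c * S₁ := by nlinarith [h1, h2, e1, e2, e0']
  calc cK * N₁ ≤ cK * (c * S₁) := mul_le_mul_of_nonneg_left hN hcK
    _ = (cK * c) * S₁ := by ring
    _ ≤ 1 * S₁ := mul_le_mul_of_nonneg_right hc hS
    _ = S₁ := one_mul _

/-- ★★ **GLUE «ElementKorn» (PROVED): (CS♯) ∧ (NC♯) ∧ (CC♯ c) ⇒ (K♯) `UniformContactKornP s Λ c₀ ℓ₀ r₁ cK`** for every `0 ≤ cK` with `cK·c ≤ 1`.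
Sum the cell certificates over the word's labelled cells (finite sums by (CS♯)), cancel the null Lagrangian by (NC♯), read off `N₁ ≤ c·S₁` by
`cell_arith`; the upper half `S₁ ≤ N₁` is termwise Cauchy–Schwarz through the tet bookkeeping identities. [g98] -/
theorem uniformContactKornP_of_cellCertificate {s Λ c₀ ℓ₀ r₁ c cK : ℝ} (hcK : 0 ≤ cK) (hc : cK * c ≤ 1) (hCS : CellSumP s Λ c₀ ℓ₀ r₁)
    (hNL : CellNullLagrangianP s Λ c₀ ℓ₀ r₁) (hCC : CellCertificateP s Λ c₀ ℓ₀ r₁ c) : UniformContactKornP s Λ c₀ ℓ₀ r₁ cK := by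
  intro a ha L w' hA φ hφ
  obtain ⟨fS, fN, fL, gS, gN, gL, eS, eN, eS', eN'⟩ := hCS a ha L w' hA φ hφ
  have e0 := hNL a ha L w' hA φ hφ
  obtain ⟨μ, hμ⟩ := hCC a ha L w' hA
  obtain ⟨htet, hoct⟩ := hμ φ
  have hS0 : 0 ≤ stretchForm 0 r₁ (gen₁ L) (gen₂ L) w' φ := stretchForm_nonneg _ _ _ _ _ _
  have h1 : 0 ≤ ∑ᶠ t : tetCells r₁ (gen₁ L) (gen₂ L) w', tetCert c μ (gen₁ L) (gen₂ L) w' φ t :=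
    finsum_nonneg fun t => htet t.1 t.2
  have h2 : 0 ≤ ∑ᶠ o : octCells r₁ (gen₁ L) (gen₂ L) w', octCert c μ (gen₁ L) (gen₂ L) w' φ o :=
    finsum_nonneg fun o => hoct o.1 o.2
  have e1 : ∑ᶠ t : tetCells r₁ (gen₁ L) (gen₂ L) w', tetCert c μ (gen₁ L) (gen₂ L) w' φ t =
      (c * (24 * stretchForm 0 r₁ (gen₁ L) (gen₂ L) w' φ) - 24 * contactForm r₁ (gen₁ L) (gen₂ L) w' φ) / 6 -
        μ * ∑ᶠ t : tetCells r₁ (gen₁ L) (gen₂ L) w', tetNL (gen₁ L) (gen₂ L) w' φ t := by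
    rw [← eS, ← eN]; exact finsum_cert_expand fS fN fL c μ 6
  have e2 : ∑ᶠ o : octCells r₁ (gen₁ L) (gen₂ L) w', octCert c μ (gen₁ L) (gen₂ L) w' φ o =
      (c * (48 * stretchForm 0 r₁ (gen₁ L) (gen₂ L) w' φ) - 48 * contactForm r₁ (gen₁ L) (gen₂ L) w' φ) / 3 -
        μ * ∑ᶠ o : octCells r₁ (gen₁ L) (gen₂ L) w', octNLw (gen₁ L) (gen₂ L) w' φ o := by
    rw [← eS', ← eN']; exact finsum_cert_expand gS gN gL c μ 3
  refine ⟨cell_arith h1 h2 e1 e2 e0 hS0 hcK hc, ?_⟩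
  have hle : ∑ᶠ t : tetCells r₁ (gen₁ L) (gen₂ L) w', tetS (gen₁ L) (gen₂ L) w' φ t ≤ ∑ᶠ t : tetCells r₁ (gen₁ L) (gen₂ L) w', tetN φ t :=
    finsum_le_finsum' fS fN fun t => tetS_le_tetN _ _ _ _ _
  rw [eS, eN] at hle
  linarith [hle]

/-- (K♯) is monotone in the Korn constant (the contact displacement form is non-negative). [g98] -/
theorem uniformContactKornP_mono {s Λ c₀ ℓ₀ r₁ cK cK' : ℝ} (hle : cK' ≤ cK) (hK : UniformContactKornP s Λ c₀ ℓ₀ r₁ cK) :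
    UniformContactKornP s Λ c₀ ℓ₀ r₁ cK' := by
  intro a ha L w' hA φ hφ
  obtain ⟨h1, h2⟩ := hK a ha L w' hA φ hφ
  exact ⟨le_trans (mul_le_mul_of_nonneg_right hle (contactForm_nonneg _ _ _ _ _)) h1, h2⟩

/-- RECORD INSTANCE at `(s, Λ) = (1/50, 2)`, `ℓ₀ = 3`, `r₁ = 9/8`: the box-of-record cell constant `c = 9` (desk CELLSDP-98: `≤ 9.00`) gives (K♯) with
`cK = 1/9`, hence NODE D's record `cK = 1/10`. [g98] -/
example {c₀ : ℝ} (hCS : CellSumP (1 / 50) 2 c₀ 3 (9 / 8)) (hNL : CellNullLagrangianP (1 / 50) 2 c₀ 3 (9 / 8))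
    (hCC : CellCertificateP (1 / 50) 2 c₀ 3 (9 / 8) 9) : UniformContactKornP (1 / 50) 2 c₀ 3 (9 / 8) (1 / 10) :=
  uniformContactKornP_mono (by norm_num)
    (uniformContactKornP_of_cellCertificate (c := 9) (cK := 1 / 9) (by norm_num) (by norm_num) hCS hNL hCC)

end Summit.AtomisticToContinuum.Crystallization.Theorems.ChartedZeroExcessLayeredLatticeLiouville

end
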